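import Literature.NumberTheory.EllipticCurves.SigmaSqDivisionBridgeProofs
import Literature.NumberTheory.EllipticCurves.PadicSigmaSqUniquenessProofs
import Literature.NumberTheory.EllipticCurves.ManinConstantQuadraticTwistAtTwoOrdinaryProofs
import HarnessLib

/-!
# The PRINT stub `stub_sigmaSqTwo` of crux C3′ (`BSDOfMainConjectureRankOneAtTwo`, line `birth`) NETTED:
# Mazur–Tate's `σ²` at `p = 2` exists uniquely ⟺ for every seed curve ONE normalised solution of the
# squared duplication identity `Σ([2]z)·z⁶ = Σ(z)⁴·(z³ψ₂(x(z)))²` is `2`-integral (route-independent)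

Cell `bsd-f1-sign2`, WIDTH-5 attach seat `bsd-line-att-p3` g8 on `route-BirchSwinnertonDyer-AlignedTransportAtTwo`
(line `birth` of crux C3′ stmt-BirchSwinnertonDyer-23008, registered stub `stub_sigmaSqTwo :
Literature.NumberTheory.EllipticCurves.mazurTate_sigmaSq_existsUnique_two`). SUPPORT file
(`--supports stmt-BirchSwinnertonDyer-23008`): THEOREMS ONLY (no definition, no named fact, no `sorry`),
imports `Literature.*` only. BSD is not proved by any of this, and the PRINT fact is NOT discharged here: this
file computes its KERNEL RESIDUE, i.e. what a discharge lineage has to construct.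

The fact (`PadicSigmaSqDivisionTwo.lean`; Mazur–Tate 1991 Thm. 3.1 at `p = 2` as printed by Silverman, Math.
Ann. 332 (2005) §5 Rem. 2): for every globally minimal elliptic `W/ℚ` with good ORDINARY reduction at `2` there
is EXACTLY ONE `Σ ∈ z² + z³ℤ₂⟦z⟧` with `z^{2(n²−1)}Σ([n]z) = Σ(z)^{n²}·z^{2(n²−1)}ψₙ²(x(z))` for all `n ≥ 1`
(`IsSigmaSqDivisionSeries`). The tree already proves, binder-free: uniqueness of sigma-squared pairs at `2` when
`a₁` is a `2`-adic unit (`IsMazurTateSigmaSqPair.unique_two_of_norm_a₁_eq_one`), «division series ⟹ pair» from the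
`n = 2` identity alone (`exists_isMazurTateSigmaSqPair_of_sigmaSqDivisionIdentity_two`) and «pair ⟹ division series»
(`IsMazurTateSigmaSqPair.isSigmaSqDivisionSeries`), and that EVERY `V/ℚ_p` carries a normalised odd FORMAL solution
of the sigma equation for every constant (`exists_isFormallyOdd_satisfiesSigmaODE`, `SatisfiesSigmaODE.mul_exp_subst`).
Assembled here:

* §1 `norm_a₁_baseChange_two_eq_one` — good ORDINARY reduction at `2` of a globally minimal `W` means
  `‖a₁(W ⊗ ℚ₂)‖ = 1` (the tree's `odd_a₁_of_hasGoodReductionAtPrime_two_of_odd_frobeniusTrace_two`).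
* §2 per curve `V/ℚ₂`, `2`-integral, elliptic, `‖a₁‖ = 1`: `existsUnique_isSigmaSqDivisionSeries_of_exists_pair`,
  `…_of_exists_duplication` (ONE normalised `2`-integral `Σ` satisfying the `n = 2` identity gives the `∃!`),
  `…_of_exists_sq` (the square of a normalised odd formal solution with `2`-integral SQUARE gives the `∃!`), and
  `isMazurTateSigmaSqPair_sq_of_norm_coeff_sq_le` (such a square IS a sigma-squared pair).
* §3 the fact as an `Iff`, three currencies: `mazurTate_sigmaSq_existsUnique_two_iff_forall_exists_pair`,
  `…_iff_forall_exists_duplication`, `…_iff_forall_exists_sq` — **modulo nothing, the PRINT stub is EQUIVALENT to: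
  for every globally minimal good-ordinary-at-`2` `W/ℚ`, SOME member of the one-parameter family
  `σ_ε = σ₀·exp(ε·log_W²)` of normalised odd formal solutions of `x + c = −D(Dσ/σ)` on `W ⊗ ℚ₂` has a
  `2`-INTEGRAL SQUARE** (`σ` itself never is: `[z²]σ = a₁/2`). This is the exact target of a Blakestad–Grant-type
  construction at `p = 2` (universal ordinary `a₁`-chart, Frobenius lift = Vélu quotient by the `ℚ₂`-rational
  canonical subgroup `μ₂`, squared Prop. 13 + Dwork), cf. the tree's `mazur_tate_sigma_existsUnique_holds` (`p ≥ 5`)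
  and `mazur_tate_sigma_exists_odd_holds` (`p = 3`), and of Perrin-Riou's CM argument already in the tree
  (`CMSigmaSqIntegralityProofs`: the CM seed `X₀(49)`).
* §4 `sigmaSqDivisionIdentity_two_iff_subst_formalMul` — the `n = 2` identity for `Σ = z²·h` in DWORK FORM:
  `h([2]z)·([2]z/z)² = h(z)⁴·Ỹ(z)²`, `Ỹ = z³(2y + a₁x + a₃)` (`formalYTilde`), `[2]z/z = 2 − a₁z − ⋯`.

## Sources

* B. Mazur, J. Tate, *The `p`-adic sigma function*, Duke Math. J. 62 (1991), §2 and Thm. 3.1 (cite-only on the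
  hub, acq-00916). [cite: MazurTate1991, Thm. 3.1]
* J. H. Silverman, Math. Ann. 332 (2005) = arXiv math/0404412, §5 Thm. 11 and Remark 2 («Theorem 11 remains true
  for `p = 2` provided that everything is squared», held text `paper:arxiv-math_0404412` p0010–p0011).
  [cite: Silverman2005DivPoly, §5 Rem. 2]
* B. Mazur, W. Stein, J. Tate, Doc. Math. Extra Vol. Coates (2006), Thm. 1.3, §3.1. [cite: MazurSteinTate2006, Thm. 1.3]
* C. Blakestad, D. Grant, J. Number Theory 249 (2023), Thm. 1, Prop. 13. [cite: BlakestadGrant2023, Thm. 1]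
-/

noncomputable section

set_option linter.dupNamespace false
set_option autoImplicit false

open scoped Classical
open PowerSeries WeierstrassCurve Literature.NumberTheory.EllipticCurves

namespace Summit.BirchSwinnertonDyer.BirchSwinnertonDyer.Theorems.AlignedTransportAtTwoSigmaSqTwo

/-! ## §1 Good ordinary reduction at `2` ⟹ `a₁` is a `2`-adic unit -/

/-- **Good ORDINARY reduction at `2` of a globally minimal `W/ℚ` forces `‖a₁(W ⊗ ℚ₂)‖₂ = 1`**: the minimal
equation has `a₁` odd (in characteristic `2`, supersingular ⟺ `ā₁ = 0`; tree lemma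
`odd_a₁_of_hasGoodReductionAtPrime_two_of_odd_frobeniusTrace_two`), and an odd integer is a `2`-adic unit.
[cite: SilvermanAEC2009, V.4 and Exercise 5.7] -/
theorem norm_a₁_baseChange_two_eq_one (W : WeierstrassCurve ℚ) [W.IsElliptic] [W.IsGloballyMinimal]
    (hgood : W.HasGoodReductionAtPrime 2) (hord : ¬ (2 : ℤ) ∣ W.frobeniusTrace 2) :
    ‖(W.baseChange ℚ_[2]).a₁‖ = 1 := by
  have hodd : Odd (integralModelInt W).a₁ :=
    odd_a₁_of_hasGoodReductionAtPrime_two_of_odd_frobeniusTrace_two W hgood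
      (Int.not_even_iff_odd.mp fun h ↦ hord (even_iff_two_dvd.mp h))
  have ha : (W.baseChange ℚ_[2]).a₁ = (((integralModelInt W).a₁ : ℤ) : ℚ_[2]) := by
    conv_lhs => rw [← map_integralModelInt W]
    simp [WeierstrassCurve.baseChange, WeierstrassCurve.map]
  rw [ha]
  refine le_antisymm (Padic.norm_int_le_one _) ?_
  by_contra hlt
  have hlt' : ‖(((integralModelInt W).a₁ : ℤ) : ℚ_[2])‖ < 1 := lt_of_not_ge hlt
  rw [Padic.norm_intCast_lt_one_iff] at hlt'
  exact (Int.not_even_iff_odd.mpr hodd) (even_iff_two_dvd.mpr (by exact_mod_cast hlt'))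

/-! ## §2 Per curve over `ℚ₂`: one integral solution of the duplication identity gives the `∃!` -/

section PerCurve

variable (V : WeierstrassCurve ℚ_[2]) [V.IsIntegral ℤ_[2]] [V.IsElliptic]

variable {V} in
/-- **Two sigma-squared division series of a `2`-integral `V/ℚ₂` with `a₁ ∈ ℤ₂ˣ` coincide** — the uniqueness
clause of the PRINT fact, binder-free (each is a sigma-squared pair by the bridge; pairs are unique because
`log_V` has unbounded coefficients when `a₁` is a unit). [cite: Silverman2005DivPoly, §5 Rem. 2]
[cite: MazurTate1991, Thm. 3.1] -/
theorem IsSigmaSqDivisionSeries.eq_of_norm_a₁_eq_one (ha : ‖V.a₁‖ = 1) {S₁ S₂ : ℚ_[2]⟦X⟧}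
    (h₁ : V.IsSigmaSqDivisionSeries S₁) (h₂ : V.IsSigmaSqDivisionSeries S₂) : S₁ = S₂ := by
  obtain ⟨c₁, hc₁⟩ := h₁.exists_isMazurTateSigmaSqPair
  obtain ⟨c₂, hc₂⟩ := h₂.exists_isMazurTateSigmaSqPair
  exact (IsMazurTateSigmaSqPair.unique_two_of_norm_a₁_eq_one V ha hc₁ hc₂).1

/-- **ONE sigma-squared pair gives the `∃!` of the PRINT fact** (per curve, `a₁ ∈ ℤ₂ˣ`).
[cite: Silverman2005DivPoly, §5 Rem. 2] [cite: MazurTate1991, Thm. 3.1] -/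
theorem existsUnique_isSigmaSqDivisionSeries_of_exists_pair (ha : ‖V.a₁‖ = 1)
    (hex : ∃ Sq : ℚ_[2]⟦X⟧, ∃ c : ℚ_[2], V.IsMazurTateSigmaSqPair Sq c) :
    ∃! Sq : ℚ_[2]⟦X⟧, V.IsSigmaSqDivisionSeries Sq := by
  obtain ⟨Sq, c, h⟩ := hex
  exact ⟨Sq, h.isSigmaSqDivisionSeries, fun S hS ↦
    IsSigmaSqDivisionSeries.eq_of_norm_a₁_eq_one ha hS h.isSigmaSqDivisionSeries⟩

/-- **ONE normalised `2`-integral solution of the squared DUPLICATION identity gives the `∃!`**: if some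
`Σ = z² + O(z³) ∈ ℤ₂⟦z⟧` satisfies `z⁶·Σ([2]z) = Σ(z)⁴·z⁶ψ₂²(x(z))` (`SigmaSqDivisionIdentity Σ 2`), then
`V` has exactly one sigma-squared division series (the `n = 2` identity alone makes `Σ` a sigma-squared pair,
tree `exists_isMazurTateSigmaSqPair_of_sigmaSqDivisionIdentity_two`). [cite: Silverman2005DivPoly, §5 Rem. 2]
[cite: MazurTate1991, Thm. 3.1] -/
theorem existsUnique_isSigmaSqDivisionSeries_of_exists_duplication (ha : ‖V.a₁‖ = 1)
    (hex : ∃ Sq : ℚ_[2]⟦X⟧, constantCoeff Sq = 0 ∧ coeff 1 Sq = 0 ∧ coeff 2 Sq = 1 ∧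
      (∀ n, ‖coeff n Sq‖ ≤ 1) ∧ V.SigmaSqDivisionIdentity Sq 2) :
    ∃! Sq : ℚ_[2]⟦X⟧, V.IsSigmaSqDivisionSeries Sq := by
  obtain ⟨Sq, h0, h1, h2, hint, hid⟩ := hex
  obtain ⟨c, hc⟩ := V.exists_isMazurTateSigmaSqPair_of_sigmaSqDivisionIdentity_two h0 h1 h2 hint hid
  exact existsUnique_isSigmaSqDivisionSeries_of_exists_pair V ha ⟨Sq, c, hc⟩

variable {V} in
/-- **The square of a normalised odd formal solution is a sigma-squared pair as soon as the SQUARE is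
`p`-integral** (any `p`): `σ = z + ⋯`, `σ(i(z)) = −σ(z)`, `x + c = −D(Dσ/σ)` and `σ² ∈ ℤ_p⟦z⟧` give
`IsMazurTateSigmaSqPair (σ²) c` — no integrality of `σ` or of `c` is needed (at `p = 2` with `a₁` odd, `σ` is
never integral: `[z²]σ = a₁/2`). Compare the tree's `IsMazurTateSigmaPair.sq` (which asks `σ` integral).
[cite: Silverman2005DivPoly, §5 Rem. 2] [cite: MazurSteinTate2006, Thm. 1.3] -/
theorem isMazurTateSigmaSqPair_sq_of_norm_coeff_sq_le {p : ℕ} [Fact p.Prime] {U : WeierstrassCurve ℚ_[p]}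
    {σ : ℚ_[p]⟦X⟧} {c : ℚ_[p]} (h0 : constantCoeff σ = 0) (h1 : coeff 1 σ = 1) (hodd : U.IsFormallyOdd σ)
    (hODE : U.SatisfiesSigmaODE σ c) (hint : ∀ n, ‖coeff n (σ ^ 2)‖ ≤ 1) :
    U.IsMazurTateSigmaSqPair (σ ^ 2) c where
  constantCoeff_eq := by rw [map_pow, h0, zero_pow two_ne_zero]
  coeff_one_eq := by
    rw [pow_two, coeff_one_mul_eq, coeff_zero_eq_constantCoeff_apply, h0]; ring
  coeff_two_eq := by
    rw [pow_two, coeff_two_mul_eq, coeff_zero_eq_constantCoeff_apply, h0, h1]; ring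
  norm_coeff_le := hint
  even := hodd.sq
  ode := hODE.sq h0 h1

/-- **ONE normalised odd formal solution with `2`-integral SQUARE gives the `∃!`** (per curve, `a₁ ∈ ℤ₂ˣ`).
[cite: Silverman2005DivPoly, §5 Rem. 2] [cite: MazurTate1991, Thm. 3.1] -/
theorem existsUnique_isSigmaSqDivisionSeries_of_exists_sq (ha : ‖V.a₁‖ = 1)
    (hex : ∃ σ : ℚ_[2]⟦X⟧, ∃ c : ℚ_[2], constantCoeff σ = 0 ∧ coeff 1 σ = 1 ∧ V.IsFormallyOdd σ ∧
      V.SatisfiesSigmaODE σ c ∧ ∀ n, ‖coeff n (σ ^ 2)‖ ≤ 1) :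
    ∃! Sq : ℚ_[2]⟦X⟧, V.IsSigmaSqDivisionSeries Sq := by
  obtain ⟨σ, c, h0, h1, hodd, hODE, hint⟩ := hex
  exact existsUnique_isSigmaSqDivisionSeries_of_exists_pair V ha
    ⟨σ ^ 2, c, isMazurTateSigmaSqPair_sq_of_norm_coeff_sq_le h0 h1 hodd hODE hint⟩

variable {V} in
/-- Conversely **a sigma-squared division series is the square of a normalised odd formal solution** (whose
square is then integral): the shape in which the PRINT fact hands its `Σ` to the height files.
[cite: MazurTate1991, Thm. 3.1] [cite: Silverman2005DivPoly, §5 Rem. 2] -/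
theorem IsSigmaSqDivisionSeries.exists_sq_eq {Sq : ℚ_[2]⟦X⟧} (h : V.IsSigmaSqDivisionSeries Sq) :
    ∃ σ : ℚ_[2]⟦X⟧, ∃ c : ℚ_[2], constantCoeff σ = 0 ∧ coeff 1 σ = 1 ∧ V.IsFormallyOdd σ ∧
      V.SatisfiesSigmaODE σ c ∧ (∀ n, ‖coeff n (σ ^ 2)‖ ≤ 1) ∧ Sq = σ ^ 2 := by
  obtain ⟨c, hc⟩ := h.exists_isMazurTateSigmaSqPair
  obtain ⟨σ, h0, h1, hodd, hODE, hSq⟩ := hc.exists_sq_eq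
  refine ⟨σ, c, h0, h1, hodd, hODE, fun n ↦ ?_, hSq⟩
  rw [← hSq]
  exact hc.norm_coeff_le n

end PerCurve

/-! ## §3 The PRINT fact as an `Iff`: three currencies for its kernel residue -/

/-- **`mazurTate_sigmaSq_existsUnique_two` ⟺ every globally minimal good-ordinary-at-`2` `W/ℚ` carries SOME
sigma-squared pair over `ℚ₂`.** (⟹ is the tree's `exists_isMazurTateSigmaSqPair_two`; ⟸ is §2 with §1.)
[cite: Silverman2005DivPoly, §5 Rem. 2] [cite: MazurTate1991, Thm. 3.1] -/
theorem mazurTate_sigmaSq_existsUnique_two_iff_forall_exists_pair :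
    mazurTate_sigmaSq_existsUnique_two ↔
      ∀ (W : WeierstrassCurve ℚ) [W.IsElliptic] [W.IsGloballyMinimal],
        W.HasGoodReductionAtPrime 2 → ¬ (2 : ℤ) ∣ W.frobeniusTrace 2 →
          ∃ Sq : ℚ_[2]⟦X⟧, ∃ c : ℚ_[2], (W.baseChange ℚ_[2]).IsMazurTateSigmaSqPair Sq c := by
  refine ⟨fun h W _ _ hgood hord ↦ W.exists_isMazurTateSigmaSqPair_two h hgood hord,
    fun h W _ _ hgood hord ↦ ?_⟩
  exact existsUnique_isSigmaSqDivisionSeries_of_exists_pair (W.baseChange ℚ_[2])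
    (norm_a₁_baseChange_two_eq_one W hgood hord) (h W hgood hord)

/-- **`mazurTate_sigmaSq_existsUnique_two` ⟺ on every such `W ⊗ ℚ₂` the squared DUPLICATION identity
`z⁶·Σ([2]z) = Σ(z)⁴·z⁶ψ₂(x(z))²` has a normalised (`Σ = z² + O(z³)`) `2`-INTEGRAL solution** — ONE identity on
ONE curve, no `n ≥ 3`, no differential equation, no constant. [cite: Silverman2005DivPoly, §5 Rem. 2]
[cite: MazurTate1991, Thm. 3.1] -/
theorem mazurTate_sigmaSq_existsUnique_two_iff_forall_exists_duplication :
    mazurTate_sigmaSq_existsUnique_two ↔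
      ∀ (W : WeierstrassCurve ℚ) [W.IsElliptic] [W.IsGloballyMinimal],
        W.HasGoodReductionAtPrime 2 → ¬ (2 : ℤ) ∣ W.frobeniusTrace 2 →
          ∃ Sq : ℚ_[2]⟦X⟧, constantCoeff Sq = 0 ∧ coeff 1 Sq = 0 ∧ coeff 2 Sq = 1 ∧
            (∀ n, ‖coeff n Sq‖ ≤ 1) ∧ (W.baseChange ℚ_[2]).SigmaSqDivisionIdentity Sq 2 := by
  refine ⟨fun h W _ _ hgood hord ↦ ?_, fun h W _ _ hgood hord ↦ ?_⟩
  · obtain ⟨Sq, hSq⟩ := exists_isSigmaSqDivisionSeries_two h W hgood hord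
    exact ⟨Sq, hSq.1, hSq.2.1, hSq.2.2.1, hSq.2.2.2.1, hSq.identity (by norm_num)⟩
  · exact existsUnique_isSigmaSqDivisionSeries_of_exists_duplication (W.baseChange ℚ_[2])
      (norm_a₁_baseChange_two_eq_one W hgood hord) (h W hgood hord)

/-- **`mazurTate_sigmaSq_existsUnique_two` ⟺ on every such `W ⊗ ℚ₂` SOME normalised odd formal solution
`σ = z + ⋯` of Mazur–Tate's equation `x + c = −D(Dσ/σ)` (they exist for every `c`, one-parameter family
`σ₀·exp(ε log_W²)`) has a `2`-INTEGRAL SQUARE.** This is the existence statement of Mazur–Tate 1991 §2 at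
`p = 2` («everything squared»), isolated as the residue the tree does not prove.
[cite: MazurTate1991, Thm. 3.1] [cite: MazurSteinTate2006, Thm. 1.3] [cite: Silverman2005DivPoly, §5 Rem. 2] -/
theorem mazurTate_sigmaSq_existsUnique_two_iff_forall_exists_sq :
    mazurTate_sigmaSq_existsUnique_two ↔
      ∀ (W : WeierstrassCurve ℚ) [W.IsElliptic] [W.IsGloballyMinimal],
        W.HasGoodReductionAtPrime 2 → ¬ (2 : ℤ) ∣ W.frobeniusTrace 2 →
          ∃ σ : ℚ_[2]⟦X⟧, ∃ c : ℚ_[2], constantCoeff σ = 0 ∧ coeff 1 σ = 1 ∧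
            (W.baseChange ℚ_[2]).IsFormallyOdd σ ∧ (W.baseChange ℚ_[2]).SatisfiesSigmaODE σ c ∧
            ∀ n, ‖coeff n (σ ^ 2)‖ ≤ 1 := by
  refine ⟨fun h W _ _ hgood hord ↦ ?_, fun h W _ _ hgood hord ↦ ?_⟩
  · obtain ⟨Sq, hSq⟩ := exists_isSigmaSqDivisionSeries_two h W hgood hord
    obtain ⟨σ, c, h0, h1, hodd, hODE, hint, -⟩ := IsSigmaSqDivisionSeries.exists_sq_eq hSq
    exact ⟨σ, c, h0, h1, hodd, hODE, hint⟩
  · exact existsUnique_isSigmaSqDivisionSeries_of_exists_sq (W.baseChange ℚ_[2])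
      (norm_a₁_baseChange_two_eq_one W hgood hord) (h W hgood hord)

/-! ## §4 The duplication identity in Dwork form: `h([2]z)·([2]z/z)² = h(z)⁴·Ỹ(z)²` for `Σ = z²h` -/

section DworkForm

variable {p : ℕ} [Fact p.Prime] (V : WeierstrassCurve ℚ_[p])

/-- `[2](z) = z · m(z)` with `m = [2]z/z = 2 − a₁z − ⋯` (`[2](0) = 0`). [cite: SilvermanAEC2009, IV.2.3] -/
theorem formalMul_two_eq_X_mul :
    V.formalMul 2 = X * PowerSeries.mk fun n ↦ coeff (n + 1) (V.formalMul 2) := by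
  have h := PowerSeries.eq_shift_mul_X_add_const (V.formalMul 2)
  rw [constantCoeff_formalMul, map_zero, add_zero, mul_comm] at h
  exact h

/-- `P₂ = Ỹ²`: the pole-cleared squared `2`-division polynomial `z⁶ψ₂²(x(z))` (`sigmaSqDivisionRHS 2`) is the
square of `Ỹ = z³(2y + a₁x + a₃) = (a₁z − 2)X + a₃z³` (`formalYTilde`). [cite: SilvermanAEC2009, III.1 and Exercise 3.7] -/
theorem sigmaSqDivisionRHS_two_eq_formalYTilde_sq : V.sigmaSqDivisionRHS 2 = V.formalYTilde ^ 2 := by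
  rw [sigmaSqDivisionRHS_two, formalYTilde_sq_eq]

/-- **The squared duplication identity in DWORK FORM.** For `Σ = z²·h`: `z⁶·Σ([2]z) = Σ⁴·P₂` ⟺
`h([2]z)·m(z)² = h(z)⁴·Ỹ(z)²`, where `m = [2]z/z = 2 − a₁z − 2a₂z² + ⋯` and `Ỹ = z³(2y + a₁x + a₃) =
−2 + a₁z + ⋯`; at an ordinary `2` both `m` and `Ỹ` vanish at the parameter `t_Q ∈ 2ℤ₂` of the `ℚ₂`-rational
canonical `2`-torsion point, and `m ≡ Ỹ ≡ a₁z + ⋯ (mod 2)` — the functional equation a discharge must solve in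
`1 + a₁z + z²ℤ₂⟦z⟧`. [cite: Silverman2005DivPoly, §5 Thm. 11 (18) and Rem. 2] [cite: SilvermanAEC2009, IV.2.3] -/
theorem sigmaSqDivisionIdentity_two_iff_subst_formalMul (h : ℚ_[p]⟦X⟧) :
    V.SigmaSqDivisionIdentity (X ^ 2 * h) 2 ↔
      h.subst (V.formalMul 2) * (PowerSeries.mk fun n ↦ coeff (n + 1) (V.formalMul 2)) ^ 2 =
        h ^ 4 * V.formalYTilde ^ 2 := by
  set m : ℚ_[p]⟦X⟧ := PowerSeries.mk fun n ↦ coeff (n + 1) (V.formalMul 2) with hm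
  have hs := V.hasSubst_formalMul 2
  have h2 : V.formalMul 2 = X * m := formalMul_two_eq_X_mul V
  have hsub : (X ^ 2 * h : ℚ_[p]⟦X⟧).subst (V.formalMul 2) = (X * m) ^ 2 * h.subst (V.formalMul 2) := by
    rw [PowerSeries.subst_mul hs, PowerSeries.subst_pow hs, PowerSeries.subst_X hs, h2]
  rw [SigmaSqDivisionIdentity, sigmaSqDivisionRHS_two_eq_formalYTilde_sq, hsub]
  norm_num
  have hX : (X : ℚ_[p]⟦X⟧) ^ 8 ≠ 0 := pow_ne_zero _ PowerSeries.X_ne_zero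
  constructor
  · intro H
    apply mul_left_cancel₀ hX
    linear_combination H
  · intro H
    linear_combination (X : ℚ_[p]⟦X⟧) ^ 8 * H

end DworkForm

end Summit.BirchSwinnertonDyer.BirchSwinnertonDyer.Theorems.AlignedTransportAtTwoSigmaSqTwo
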